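import Summits.ResolutionOfSingularities.ResolutionOfSingularities.Theorems.PurelyInseparableDim4ResConeCInfFrameEntry
import Summits.ResolutionOfSingularities.ResolutionOfSingularities.Theorems.PurelyInseparableDim4ResConeCInfFrameWindow
import Summits.ResolutionOfSingularities.ResolutionOfSingularities.Theorems.PurelyInseparableDim4ResConeCInfLetterChange
import Summits.ResolutionOfSingularities.ResolutionOfSingularities.Theorems.PurelyInseparableDim4ResConeTwoSlotBoundary
import Summits.ResolutionOfSingularities.ResolutionOfSingularities.Theorems.PurelyInseparableDim4ResConeLightResidualTwo
import Summits.ResolutionOfSingularities.ResolutionOfSingularities.Theorems.PurelyInseparableDim4ResConeWeightsPresentation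
import HarnessLib
import HarnessLib.Audit.Tags

/-!
# Purely inseparable four-folds — THE C∞ ASSEMBLY (K24c L2b): no light `d = 4` C∞ tail at `p = 5` presented without
# rotation; K2(5) ⟺ (no `d = 2` light trap) ∧ (no binary-cone trap) modulo the two-slot killer and the CHART-SWAP
# re-presentation (cell `res-dim4-pi`, K2(p) lane, slice B)

[OURS · counted 0 · cell `res-dim4-pi` · K2(p) lane holder res-dim4-p-12 g3's brick K24c «THE C∞ ASSEMBLY», layer 2b,
design ruling (iii) «LOCAL WINDOW, re-framed at the letter change» (bus 2026-08-29 02:51Z); seat res-dim4-p-3 g4 over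
the bricks of res-dim4-p-9 g3 (LC, αW), res-dim4-p-2 g4 (F2a/F2b/F2c, (VT-u)), res-dim4-typ-1 g2/g3 (F1 (P)/(VT-f), (E-u),
(D3)), res-dim4-p-1 g4 (`boundary_frozen`), res-dim4-p-11 g3 (FILE E), res-dim4-p-5 g3, res-dim4-p-7, res-dim4-p-12 g3
(K2 merge) and res-dim4-p-3 g3/g4 (K3/K4/F3, K11-lin, exact ledger, readings, transport, window).]  Nothing here proves
K2(5) (`RidgeBudget.NoAboveFloorTrap 5 5`), `NoIsolatedTrap 5 5` or resolution of singularities in dimension ≥ 4 /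
characteristic `p` — NOT proved.  AI kernel work, weaker than expert review.

* **`cInf_no_chain_of_slot`** — the C∞ killer `hγC` of `…LightResidualTwo` (res-dim4-p-2 g4's K28d dress: a witnessed
  isolated above-floor `Step0 5` chain with `x^{r₀} ∣ F₀`, shade `4` and `e_G = 3` from `k₀`, weights `(1,1)` from `k₀`,
  both boundary letters stretch-born from `k₁`) under ONE extra hypothesis, the presentation hypothesis
  **`hslot : ∀ k ≥ k₁, 1 ≤ r_k (j k)`** (NO ROTATION: every chart from `k₁` on is a boundary letter — the same
  residual as res-dim4-p-1 g4's K24a `no_twoSlot_tail_five_of_slot`): `False`.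
  ROUTE: `boundary_frozen` ⇒ fixed slots `λ, μ`; LC `exists_letter_change_of_isolated_two_slot` ⇒ a late change
  `j k = λ, j (k+1) = μ`; K13b ⇒ the contact letter `f`; `…CInfFrameEntry.exists_cInf_window_chain` at `k′ = k − 1` ⇒ a
  framed chain with the same charts; `chain_powerCone_package` + F2c `cInf_frame_window` (`N = 44`) ⇒ nine pure corner
  slot steps of straight states; `…CInfWindowLaws.cInf_window_false` ⇒ `False`.
* **`noAboveFloorTrap_five_iff_residual_two_of_slotRepresentation`** — the lane's END-STATE sentence at `p = 5`:
  **K2(5) ⟺ (no `d = 2` light power-cone trap) ∧ (no binary-cone trap)**, modulo the two-slot killer `hT2` (K24a,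
  res-dim4-p-1) and the CHART-SWAP RE-PRESENTATION `hN4` («every C∞ configuration admits a presentation without rotation» —
  idea-4 §8 N4; a necessary hypothesis: in the `ψ`-frame every step is the origin of a slot chart, but a witnessing
  may present it through the free letter `u` whenever the frame's `x_λ`-jet of `ψ` is non-zero).

[cite: CossartJannsenSaito2020, Thm. 3.10(4), Thm. 3.14, Lemma 13.2] [cite: Hauser2010, §§F–G]
bears_on: LADDER-RESOLUTION:D157-DOOR2 (res-dim4-pi · K2(p) slice B · K24c L2b THE C∞ ASSEMBLY).
Supports stmt-ResolutionOfSingularities-16155 (helper).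
-/

set_option linter.dupNamespace false -- mandated namespace of this single-conjunct summit

noncomputable section

namespace Summit.ResolutionOfSingularities.ResolutionOfSingularities.Theorems.PIDim4

namespace ResCone

open MvPolynomial Finset FrameChange
open Literature.AlgebraicGeometry.Resolution
open Literature.AlgebraicGeometry.Resolution.CentreBlowup
open Literature.AlgebraicGeometry.Resolution.Hauser2010
open Literature.AlgebraicGeometry.Resolution.HauserPerlega2019
open RidgeBudget (NoAboveFloorTrap)

variable {K : Type} [Field K]

/-! ## 1. Letters -/

/-- A weight vector with entries `≤ 1` and total weight `2` is `e_λ + e_μ` for two distinct letters. [folklore] -/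
theorem exists_pair_letters {r : Fin 4 →₀ ℕ} (h1 : ∀ i, r i ≤ 1) (hdeg : r.degree = 2) :
    ∃ la mu : Fin 4, la ≠ mu ∧ r = Finsupp.single la 1 + Finsupp.single mu 1 := by
  classical
  have hval : ∀ i ∈ r.support, r i = 1 := fun i hi => by
    have := h1 i; have := Finsupp.mem_support_iff.mp hi; omega
  have hcard : r.support.card = 2 := by
    have h : r.degree = ∑ i ∈ r.support, r i := rfl
    rw [Finset.sum_congr rfl hval, Finset.sum_const, smul_eq_mul, mul_one] at h
    omega
  obtain ⟨la, mu, hne, hsupp⟩ := Finset.card_eq_two.mp hcard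
  refine ⟨la, mu, hne, Finsupp.ext fun i => ?_⟩
  rw [Finsupp.add_apply, Finsupp.single_apply, Finsupp.single_apply]
  by_cases hi : i ∈ r.support
  · have hv := hval i hi
    rw [hsupp, Finset.mem_insert, Finset.mem_singleton] at hi
    rcases hi with rfl | rfl
    · rw [if_pos rfl, if_neg hne.symm, add_zero]; exact hv
    · rw [if_neg hne, if_pos rfl, zero_add]; exact hv
  · have h0 : r i = 0 := Finsupp.notMem_support_iff.mp hi
    rw [hsupp, Finset.mem_insert, Finset.mem_singleton, not_or] at hi
    rw [h0, if_neg (Ne.symm hi.1), if_neg (Ne.symm hi.2), add_zero]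

/-- A straight vertex form collapses the package cone: `a·(Σ ℓᵢ xᵢ)⁴ = (a ℓ_f⁴)·x_f⁴`. [OURS · bookkeeping] -/
theorem powerCone_eq_of_straight {ℓ : Fin 4 → K} {f : Fin 4} (hstraight : ∀ i, i ≠ f → ℓ i = 0) (a : K) :
    C a * (∑ i, C (ℓ i) * X i : MvPolynomial (Fin 4) K) ^ 4 = C (a * ℓ f ^ 4) * X f ^ 4 := by
  have hsum : (∑ i, C (ℓ i) * X i : MvPolynomial (Fin 4) K) = C (ℓ f) * X f := by
    rw [Finset.sum_eq_single f]
    · intro i _ hif; rw [hstraight i hif, C_0, zero_mul]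
    · intro h; exact absurd (Finset.mem_univ f) h
  rw [hsum, mul_pow, ← C_pow, ← mul_assoc, ← C_mul]

/-! ## 2. The C∞ killer under the no-rotation presentation hypothesis -/

/-- **THE C∞ ASSEMBLY (K24c L2b): NO LIGHT `d = 4` C∞ TAIL PRESENTED WITHOUT ROTATION.**  The binder block of the
C∞ killer `hγC` of `…LightResidualTwo.noAboveFloorTrap_five_iff_residual_two_of_cInf` VERBATIM, plus the presentation
hypothesis `hslot` (every chart from `k₁` on is a boundary letter): `False`. [OURS]
[cite: CossartJannsenSaito2020, Thm. 3.10(4), Thm. 3.14] -/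
theorem cInf_no_chain_of_slot (K : Type) [Field K] [CharP K 5] [DecidableEq K] (c : ℕ → State K) (j : ℕ → Fin 4)
    (b : ℕ → Fin 4 → K) (hc : ∀ k, IsIsolated 5 (c k).F ∧ Step0 5 (c k) (c (k + 1)))
    (hw : FreeTail.IsWitnessedChain 5 c j b) (hr0 : ∀ e ∈ (c 0).F.support, (c 0).r ≤ e)
    (hfloor : ∀ k, ordZero (c k).F ≠ (5 : ℕ)) (k₀ : ℕ) (hshade : ∀ k, k₀ ≤ k → (c k).shade = ((4 : ℕ) : ℕ∞))
    (he3 : ∀ k, k₀ ≤ k → Module.finrank K (resVertex (c k)) = 3) (k₁ : ℕ) (hk₁ : k₀ ≤ k₁)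
    (hwt : ∀ k, k₀ ≤ k → (∀ i, (c k).r i ≤ 1) ∧ (c k).r.degree = 2)
    (hborn : ∀ k, k₁ ≤ k → ∀ i, 1 ≤ (c k).r i →
      ∃ t, k₀ ≤ t ∧ t < k ∧ j t = i ∧ ∀ m, t < m → m < k → j m ≠ i ∧ b m i = 0)
    (hslot : ∀ k, k₁ ≤ k → 1 ≤ (c k).r (j k)) : False := by
  haveI : Fact (Nat.Prime 5) := ⟨by norm_num⟩
  have hiso : ∀ k, IsIsolated 5 (c k).F := fun k => (hc k).1
  -- order `6` on the tail
  have ho6 : ∀ k, k₁ ≤ k → ordZero (c k).F = ((5 + 1 : ℕ) : ℕ∞) := fun k hk => by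
    obtain ⟨o, ho, hpo, -, hod⟩ := chain_shade_nat 5 hc hfloor hshade (hk₁.trans hk)
    rw [(hwt k (hk₁.trans hk)).2] at hod
    rw [ho]; congr 1; omega
  -- (1) slots: the boundary is frozen from `k₁`
  have hfro := boundary_frozen 5 hw (k₁ := k₁) (D := 2) ho6 (fun k hk => (hwt k (hk₁.trans hk)).2)
    (fun k hk => (hwt k (hk₁.trans hk)).1) hslot
  obtain ⟨la, mu, hlm, hr₁⟩ := exists_pair_letters (hwt k₁ hk₁).1 (hwt k₁ hk₁).2
  have hrk : ∀ k, k₁ ≤ k → (c k).r = Finsupp.single la 1 + Finsupp.single mu 1 := fun k hk => by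
    rw [(hfro k hk).1, hr₁]
  have hjk : ∀ k, k₁ ≤ k → j k = la ∨ j k = mu := fun k hk => by
    by_contra hne
    push Not at hne
    have h := hslot k hk
    rw [hrk k hk, Finsupp.add_apply, Finsupp.single_eq_of_ne hne.1, Finsupp.single_eq_of_ne hne.2] at h
    omega
  have hbk : ∀ k, k₁ ≤ k → b k la = 0 ∧ b k mu = 0 := fun k hk => by
    have h := (hfro k hk).2
    rw [hr₁] at h
    refine ⟨h la ?_, h mu ?_⟩
    · rw [Finsupp.add_apply, Finsupp.single_eq_same, Finsupp.single_eq_of_ne hlm]; omega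
    · rw [Finsupp.add_apply, Finsupp.single_eq_of_ne (Ne.symm hlm), Finsupp.single_eq_same]; omega
  -- (2) the power-cone package
  obtain ⟨ℓ, a0, lam, hpkg⟩ := chain_powerCone_package 5 hc hw hr0 hfloor (by norm_num) hshade he3
  have hform : ∀ k, k₀ ≤ k → resForm (c k) = C (a0 k) * (∑ i, C (ℓ k i) * X i) ^ 4 := fun k hk => (hpkg k hk).2.2.1
  have hdir : ∀ k, k₀ ≤ k → ℓ k (j k) + dotProduct (ℓ k) (b k) = 0 := fun k hk => (hpkg k hk).2.2.2.1
  have hlam : ∀ k, k₀ ≤ k → lam k ≠ 0 := fun k hk => (hpkg k hk).2.2.2.2.1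
  have hprop : ∀ k, k₀ ≤ k → ∀ i, i ≠ j k → ℓ (k + 1) i = lam k * ℓ k i := fun k hk => (hpkg k hk).2.2.2.2.2.1
  have hcarry : ∀ k, k₀ ≤ k → ∃ i, i ≠ j k ∧ ℓ k i ≠ 0 := fun k hk => (hpkg k hk).2.2.2.2.2.2
  -- (3) a late letter change `λ → μ` at `k = k′ + 1`
  obtain ⟨k, hkN, hjla, hjmu⟩ := exists_letter_change_of_isolated_two_slot 5 hw hiso hjk (k₁ + 2)
  obtain ⟨k', rfl⟩ : ∃ k', k = k' + 1 := ⟨k - 1, by omega⟩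
  have hk'₁ : k₁ ≤ k' := by omega
  have hk'₀ : k₀ ≤ k' := hk₁.trans hk'₁
  -- (4) births of the two slot letters before `k′`, and the contact letter `f`
  obtain ⟨ta, hta, htak, hja, hkepta⟩ := hborn k' hk'₁ la (Nat.one_le_iff_ne_zero.mpr (by
    rw [hrk k' hk'₁, Finsupp.add_apply, Finsupp.single_eq_same, Finsupp.single_eq_of_ne hlm]; omega))
  obtain ⟨tb, htb, htbk, hjb, hkeptb⟩ := hborn k' hk'₁ mu (Nat.one_le_iff_ne_zero.mpr (by
    rw [hrk k' hk'₁, Finsupp.add_apply, Finsupp.single_eq_of_ne (Ne.symm hlm), Finsupp.single_eq_same]; omega))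
  have hbj : ∀ k, b k (j k) = 0 := fun k => (hw k).2.1
  have hf : ∃ f : Fin 4, f ≠ la ∧ f ≠ mu ∧ ℓ k' f ≠ 0 := by
    rcases Nat.lt_or_gt_of_ne (show ta ≠ tb from fun h => hlm (by rw [← hja, ← hjb, h])) with hlt | hlt
    · obtain ⟨m, h1, h2, h3⟩ := contactSupport_not_subset_pair hdir hlam hprop hcarry hbj hta hlt htbk
        (fun m hm hmk => by rw [hja]; exact hkepta m hm hmk) (fun m hm hmk => by rw [hjb]; exact hkeptb m hm hmk)
      exact ⟨m, by rw [← hja]; exact h1, by rw [← hjb]; exact h2, h3⟩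
    · obtain ⟨m, h1, h2, h3⟩ := contactSupport_not_subset_pair hdir hlam hprop hcarry hbj htb hlt htak
        (fun m hm hmk => by rw [hjb]; exact hkeptb m hm hmk) (fun m hm hmk => by rw [hja]; exact hkepta m hm hmk)
      exact ⟨m, by rw [← hja]; exact h2, by rw [← hjb]; exact h1, h3⟩
  obtain ⟨f, hfl, hfm, hℓf⟩ := hf
  obtain ⟨u, hul, hum, huf, -⟩ := exists_fourth_letter hlm hfl.symm hfm.symm
  -- (5) the framed window chain
  obtain ⟨c₃, b₃, hw₃, hc₃, hinv₃, ⟨A, hA, hres₃⟩, hled₃, hrow₃, hV₃⟩ :=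
    exists_cInf_window_chain hc hw hr0 hfloor hshade he3 hform hdir hlam hprop hcarry hlm hul.symm hfl.symm hum.symm
      hfm.symm huf hk'₀ (by omega) (fun m hm => hrk m (hk'₁.trans hm)) (fun m hm => hjk m (hk'₁.trans hm))
      (hbk k' hk'₁).1 (hbk k' hk'₁).2 hℓf hta htak hja hkepta htb htbk hjb hkeptb
  have ho₃ : ∀ m, ordZero (c₃ m).F = (6 : ℕ) := fun m => (hinv₃ m).1
  have hdiv₃ : ∀ m, ∀ e ∈ (c₃ m).F.support, (c₃ m).r ≤ e := fun m => (hinv₃ m).2.2.2.2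
  have hr₃ : ∀ m, (c₃ m).r = Finsupp.single la 1 + Finsupp.single mu 1 := fun m => (hinv₃ m).2.2.2.1
  have hfloor₃ : ∀ m, ordZero (c₃ m).F ≠ (5 : ℕ) := fun m => by
    rw [ho₃ m]; exact_mod_cast (by norm_num : (6 : ℕ) ≠ 5)
  have hshade₃ : ∀ m, 0 ≤ m → (c₃ m).shade = ((4 : ℕ) : ℕ∞) := fun m _ => (hinv₃ m).2.1
  have he3₃ : ∀ m, 0 ≤ m → Module.finrank K (resVertex (c₃ m)) = 3 := fun m _ => (hinv₃ m).2.2.1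
  -- (6) the package of the framed chain and F2c's window
  obtain ⟨ℓ₃, a₃, lam₃, hpkg₃⟩ := chain_powerCone_package 5 hc₃ hw₃ (hdiv₃ 0) hfloor₃ (by norm_num) hshade₃ he3₃
  have hstraight₃ : ∀ i, i ≠ f → ℓ₃ 0 i = 0 := straight_of_resForm_eq hA (hpkg₃ 0 le_rfl).2.2.1 hres₃
  have hwin := cInf_frame_window hc₃ hw₃ (hdiv₃ 0) hfloor₃ hshade₃
    (fun m _ => by rw [hr₃ m, map_add, Finsupp.degree_single, Finsupp.degree_single])
    (fun m hm => (hpkg₃ m hm).1) (fun m hm => (hpkg₃ m hm).2.2.1) (fun m hm => (hpkg₃ m hm).2.2.2.1)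
    (fun m hm => (hpkg₃ m hm).2.2.2.2.1) (fun m hm => (hpkg₃ m hm).2.2.2.2.2.1) hlm hul.symm hfl.symm hum.symm hfm.symm
    huf (k := 0) le_rfl hstraight₃ (hr₃ 0) (N := 44) (fun d hd hdf _ => hled₃ d hd hdf) hrow₃ hV₃
  -- (7) the window is played
  refine cInf_window_false hlm hul.symm hfl.symm hum.symm hfm.symm huf (c := c₃) (j := fun m => j (k' + 1 + m))
    (fun t _ => (hc₃ t).1) (fun t _ => ho₃ t) (fun t _ => (hinv₃ t).2.2.1) (fun t _ => hdiv₃ t) ?_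
    (fun t _ => hjk (k' + 1 + t) (by omega)) (fun t _ => hr₃ t) ?_ hled₃ ?_ ?_
  · intro t ht
    have h := (hwin t (by omega)).2.2.2
    simp only [Nat.zero_add] at h
    exact h
  · intro t ht
    obtain ⟨hℓt, -, hformt, -⟩ := hpkg₃ t (Nat.zero_le t)
    have hst : ∀ i, i ≠ f → ℓ₃ t i = 0 := by
      have h := (hwin t (by omega)).1.1
      simp only [Nat.zero_add] at h
      exact h
    refine ⟨a₃ t * ℓ₃ t f ^ 4, ?_, by rw [hformt, powerCone_eq_of_straight hst]⟩
    refine straighten_coeff_ne_zero (ne_zero_of_resForm_eq_C_mul (ho₃ t) (hdiv₃ t) hformt) (fun h0 => hℓt ?_) 4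
    funext i
    by_cases hif : i = f
    · rw [hif, h0, Pi.zero_apply]
    · rw [hst i hif, Pi.zero_apply]
  · show j (k' + 1 + 0) = la
    rw [Nat.add_zero]; exact hjla
  · show j (k' + 1 + 1) = mu
    exact hjmu

/-! ## 3. The END-STATE sentence at `p = 5`, modulo the two-slot killer and the chart-swap re-presentation -/

/-- **K2(5) ⟺ (no `d = 2` light power-cone trap) ∧ (no binary-cone trap)** — the K2(p) lane's slice-B END-STATE
sentence at `p = 5`, MODULO the two-slot killer `hT2` (res-dim4-p-1's K24a, in K27a's dress) and the CHART-SWAP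
RE-PRESENTATION `hN4` of the C∞ configuration (idea-4 §8 N4: every chain in the C∞ killer's binder block admits a
presentation satisfying the same block AND `hslot` — no rotation through a free letter from `k₁` on).  Composition of
`…LightResidualTwo.noAboveFloorTrap_five_iff_residual_two_of_cInf` with `cInf_no_chain_of_slot`. [OURS]
[cite: CossartJannsenSaito2020, Thm. 3.14] -/
theorem noAboveFloorTrap_five_iff_residual_two_of_slotRepresentation
    (hT2 : ∀ (K : Type) [Field K] [CharP K 5] [DecidableEq K] (c : ℕ → State K) (j : ℕ → Fin 4)
      (b : ℕ → Fin 4 → K), (∀ k, IsIsolated 5 (c k).F ∧ Step0 5 (c k) (c (k + 1))) →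
      FreeTail.IsWitnessedChain 5 c j b → (∀ e ∈ (c 0).F.support, (c 0).r ≤ e) →
      (∀ k, ordZero (c k).F ≠ (5 : ℕ)) → ∀ k₀ : ℕ, (∀ k, k₀ ≤ k → (c k).shade = ((3 : ℕ) : ℕ∞)) →
      (∀ k, k₀ ≤ k → Module.finrank K (resVertex (c k)) = 3) →
      ∀ (ν : Fin 4) (k₁ : ℕ), k₀ ≤ k₁ → (∀ k, k₁ ≤ k → 1 ≤ (c k).r ν ∧ j k ≠ ν ∧ b k ν = 0) →
      (∀ k, k₁ ≤ k → ∀ i, i ≠ ν → 1 ≤ (c k).r i →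
        ∃ t, k₀ ≤ t ∧ t < k ∧ j t = i ∧ ∀ m, t < m → m < k → j m ≠ i ∧ b m i = 0) → False)
    (hN4 : ∀ (K : Type) [Field K] [CharP K 5] [DecidableEq K] (c : ℕ → State K) (j : ℕ → Fin 4)
      (b : ℕ → Fin 4 → K), (∀ k, IsIsolated 5 (c k).F ∧ Step0 5 (c k) (c (k + 1))) →
      FreeTail.IsWitnessedChain 5 c j b → (∀ e ∈ (c 0).F.support, (c 0).r ≤ e) →
      (∀ k, ordZero (c k).F ≠ (5 : ℕ)) → ∀ k₀ : ℕ, (∀ k, k₀ ≤ k → (c k).shade = ((4 : ℕ) : ℕ∞)) →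
      (∀ k, k₀ ≤ k → Module.finrank K (resVertex (c k)) = 3) →
      ∀ k₁ : ℕ, k₀ ≤ k₁ → (∀ k, k₀ ≤ k → (∀ i, (c k).r i ≤ 1) ∧ (c k).r.degree = 2) →
      (∀ k, k₁ ≤ k → ∀ i, 1 ≤ (c k).r i →
        ∃ t, k₀ ≤ t ∧ t < k ∧ j t = i ∧ ∀ m, t < m → m < k → j m ≠ i ∧ b m i = 0) →
      ∃ (c' : ℕ → State K) (j' : ℕ → Fin 4) (b' : ℕ → Fin 4 → K) (k₀' k₁' : ℕ),
        (∀ k, IsIsolated 5 (c' k).F ∧ Step0 5 (c' k) (c' (k + 1))) ∧ FreeTail.IsWitnessedChain 5 c' j' b' ∧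
        (∀ e ∈ (c' 0).F.support, (c' 0).r ≤ e) ∧ (∀ k, ordZero (c' k).F ≠ (5 : ℕ)) ∧
        (∀ k, k₀' ≤ k → (c' k).shade = ((4 : ℕ) : ℕ∞)) ∧
        (∀ k, k₀' ≤ k → Module.finrank K (resVertex (c' k)) = 3) ∧ k₀' ≤ k₁' ∧
        (∀ k, k₀' ≤ k → (∀ i, (c' k).r i ≤ 1) ∧ (c' k).r.degree = 2) ∧
        (∀ k, k₁' ≤ k → ∀ i, 1 ≤ (c' k).r i →
          ∃ t, k₀' ≤ t ∧ t < k ∧ j' t = i ∧ ∀ m, t < m → m < k → j' m ≠ i ∧ b' m i = 0) ∧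
        (∀ k, k₁' ≤ k → 1 ≤ (c' k).r (j' k))) :
    NoAboveFloorTrap 5 5 ↔ ∀ (K : Type) [Field K] [CharP K 5] [DecidableEq K],
      (¬ ∃ (c : ℕ → State K) (j : ℕ → Fin 4) (b : ℕ → Fin 4 → K),
          (∀ e' ∈ (c 0).F.support, (c 0).r ≤ e') ∧ FreeTail.IsWitnessedChain 5 c j b ∧
          (∀ k, IsIsolated 5 (c k).F ∧ Step0 5 (c k) (c (k + 1)) ∧ ordZero (c k).F ≠ (5 : ℕ) ∧
            (c k).shade = ((2 : ℕ) : ℕ∞) ∧ Module.finrank K (resVertex (c k)) = 3) ∧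
          ∀ N, ∃ k, N ≤ k ∧ FreeTail.IsSatellite j b k ∧
            ordZero (c k).F = (6 : ℕ) ∧ ordZero (c (k + 1)).F = (6 : ℕ)) ∧
      (¬ ∃ (c : ℕ → State K) (d : ℕ), 2 ≤ d ∧ d ≤ 4 ∧
          (∀ e' ∈ (c 0).F.support, (c 0).r ≤ e') ∧
          ∀ k, IsIsolated 5 (c k).F ∧ Step0 5 (c k) (c (k + 1)) ∧ ordZero (c k).F ≠ (5 : ℕ) ∧
            (c k).shade = (d : ℕ∞) ∧ Module.finrank K (resVertex (c k)) = 2) :=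
  noAboveFloorTrap_five_iff_residual_two_of_cInf hT2
    (fun K _ _ _ c j b hc hw hr0 hfloor k₀ hshade he3 k₁ hk₁ hwt hborn => by
      obtain ⟨c', j', b', k₀', k₁', hc', hw', hr0', hfloor', hshade', he3', hk₁', hwt', hborn', hslot'⟩ :=
        hN4 K c j b hc hw hr0 hfloor k₀ hshade he3 k₁ hk₁ hwt hborn
      exact cInf_no_chain_of_slot K c' j' b' hc' hw' hr0' hfloor' k₀' hshade' he3' k₁' hk₁' hwt' hborn' hslot')

end ResCone

end Summit.ResolutionOfSingularities.ResolutionOfSingularities.Theorems.PIDim4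

end
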